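import Literature.Geometry.Riemannian.ChernVectorFrame
import Literature.Geometry.Riemannian.MetricCoordMatrix
import Literature.Geometry.Riemannian.GaussBonnetGradient
import HarnessLib

/-!
# Chern's transgression field on a Riemannian `4`-manifold

The globalisation of Chern's transgression form in dimension four (Chern 1944, §1–§2; Chern 1945,
§1): for a smooth Riemannian metric `g` on a `4`-manifold `M` (modelled on `ℝ⁴`) and a vector
field `Y`, the **Chern field** `chernField g Y` is the vector field `X` with `ι_X dV_g = u^*Π`,
`u = Y/|Y|_g` the unit field (`unitSection`) and `Π` Chern's transgression `3`-form on the unit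
sphere bundle. It is defined POINTWISE and INTRINSICALLY, as the Chern vector
(`chernVecOfFrame`, `ChernVectorFrame.lean`) of the data `(g_x, u_x, R_x, (∇u)_x)` — which does not
depend on the frame used to write it — and then READ IN A CHART: its representative in the chart
at `x₁` is the coordinate Chern field `chernCoordField Ĝ Ẑ` of the components `Ĝ` of the metric
and `Ẑ` of `Y` (`vectorRep_chernField`), which in turn is `(√det g)⁻¹` times Chern's coordinate
transgression vector density `Π` of `ChernTransgression.lean` (`sqrt_det_mul_chernCoordField`).
Consequently `X` is smooth off the zeros of `Y` (`contMDiffAt_chernField`), and — the point of the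
construction — **its divergence off the zeros of `Y` is the Euler form**,
`div X = Pf(Ω) = ½(¼|W|² + σ₂(A))` (`vectorDivergence_chernField`): Chern's `Ω = dΠ` (1944,
(23)–(24)) pulled back by `u`, obtained from the coordinate identity
`div_chernTransgression_eq_eulerDensity_holds` (`ChernTransgressionDivergence.lean`) through the
divergence form `div X = (√det g)⁻¹ ∑ᵢ ∂ᵢ(√det g Xⁱ)` and the identification of `E/√det g` with
the Euler form (`pfaffOfFrame_coordBasis`, `pfaffOfFrame_metricRep`, `eulerForm_eq_pfaffOfFrame`).
This is the local identity of the vector-field (Poincaré–Hopf) proof of the Chern–Gauss–Bonnet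
theorem in dimension four; everything is proved, the definitions are explicit.

## References

* S.-S. Chern, *A simple intrinsic proof of the Gauss–Bonnet formula for closed Riemannian
  manifolds*, Ann. of Math. 45 (1944) 747–752, §1–§2. [Chern1944]
* S.-S. Chern, *On the curvatura integra in a Riemannian manifold*, Ann. of Math. 46 (1945)
  674–684, §1, (9). [Chern1945]
* B. O'Neill, *Semi-Riemannian geometry*, Academic Press 1983, Ch. 3, Prop. 3.59 (naturality of
  `∇` and `R` under local isometries). [ONeill1983]
-/

noncomputable section

set_option maxSynthPendingDepth 3

open Set Filter Function Bundle WithLp ContinuousLinearMap Matrix VectorField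
open scoped Topology ContDiff Manifold

namespace Literature.Geometry.Riemannian

open Lorentzian Lorentzian.MetricCoord Lorentzian.PseudoRiemannianMetric

/-! ### Bundling continuous multilinear data -/

section Bundling

variable {V : Type*} [AddCommGroup V] [Module ℝ V] [TopologicalSpace V] [IsTopologicalAddGroup V]
  [ContinuousConstSMul ℝ V]

/-- A continuous trilinear map `R : V →L V →L V →L V` (a curvature endomorphism `R(X,Y)Z`) as an
algebraic trilinear map. [folklore] -/
def trilinOfCLM (R : V →L[ℝ] V →L[ℝ] V →L[ℝ] V) : V →ₗ[ℝ] V →ₗ[ℝ] V →ₗ[ℝ] V :=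
  LinearMap.mk₂ ℝ (fun X Y ↦ ((R X Y : V →L[ℝ] V) : V →ₗ[ℝ] V))
    (fun X₁ X₂ Y ↦ by
      rw [map_add, _root_.add_apply, ContinuousLinearMap.toLinearMap_add])
    (fun c X Y ↦ by
      rw [map_smul, _root_.smul_apply, ContinuousLinearMap.toLinearMap_smul])
    (fun X Y₁ Y₂ ↦ by rw [map_add, ContinuousLinearMap.toLinearMap_add])
    (fun c X Y ↦ by rw [map_smul, ContinuousLinearMap.toLinearMap_smul])

/-- Unfolding lemma for `trilinOfCLM`. [folklore] -/
@[simp] theorem trilinOfCLM_apply (R : V →L[ℝ] V →L[ℝ] V →L[ℝ] V) (X Y Z : V) :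
    trilinOfCLM R X Y Z = R X Y Z := rfl

end Bundling

section CoordBundling

variable {E : Type*} [NormedAddCommGroup E] [NormedSpace ℝ E] (G : E → E →L[ℝ] E →L[ℝ] ℝ)

/-- The coordinate curvature endomorphism `riemAt G x` (`CoordCurvature.lean`) as an algebraic
trilinear map (`riemAt_add_left`, `riemAt_smul_left`, `riemAt_add_right`, `riemAt_smul_right`).
[cite: ONeill1983, Ch. 3, Lemma 3.38] -/
def riemAtₗ (x : E) : E →ₗ[ℝ] E →ₗ[ℝ] E →ₗ[ℝ] E :=
  LinearMap.mk₂ ℝ (fun X Y ↦ ((riemAt G x X Y : E →L[ℝ] E) : E →ₗ[ℝ] E))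
    (fun X₁ X₂ Y ↦ by rw [riemAt_add_left, ContinuousLinearMap.toLinearMap_add])
    (fun c X Y ↦ by rw [riemAt_smul_left, ContinuousLinearMap.toLinearMap_smul])
    (fun X Y₁ Y₂ ↦ by rw [riemAt_add_right, ContinuousLinearMap.toLinearMap_add])
    (fun c X Y ↦ by rw [riemAt_smul_right, ContinuousLinearMap.toLinearMap_smul])

/-- Unfolding lemma for `riemAtₗ`. [folklore] -/
@[simp] theorem riemAtₗ_apply (x X Y Z : E) : riemAtₗ G x X Y Z = riemAt G x X Y Z := rfl

end CoordBundling

/-! ### The coordinate Chern field of chart data -/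

section Coord

/-- Local notation for the model space `ℝ⁴` with its Euclidean structure. -/
local notation "𝔼⁴" => EuclideanSpace ℝ (Fin 4)

variable (G : 𝔼⁴ → 𝔼⁴ →L[ℝ] 𝔼⁴ →L[ℝ] ℝ) (Z : 𝔼⁴ → 𝔼⁴)

/-- **The coordinate Chern field** of chart data: for metric components `G` and a vector field
`Z` on `ℝ⁴`, the Chern vector (`chernVecOfFrame`) of the data `(G_x, û_x, R_x, ∇û|_x)` —
`û = Z/|Z|_G` the unit field (`metricUnitField`), `∇û = covDAt G û` its covariant differential,
`R_x = riemAt G x` — read in the standard basis. Its components are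
`(√det g)⁻¹ Πᵢ` with `Π` Chern's coordinate transgression vector density
(`sqrt_det_mul_chernCoordField`). Junk where `G(Z, Z) ≤ 0`. [cite: Chern1945, (9)] -/
def chernCoordField (x : 𝔼⁴) : 𝔼⁴ :=
  chernVecOfFrame (G x).toLinearMap₁₂ (metricUnitField G Z x)
    ((covDAt G (metricUnitField G Z) x : 𝔼⁴ →L[ℝ] 𝔼⁴) : 𝔼⁴ →ₗ[ℝ] 𝔼⁴) (riemAtₗ G x)
    (coordBasis 4)

/-- Unfolding lemma for `chernCoordField`. [cite: Chern1945, (9)] -/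
theorem chernCoordField_def (x : 𝔼⁴) : chernCoordField G Z x =
    chernVecOfFrame (G x).toLinearMap₁₂ (metricUnitField G Z x)
      ((covDAt G (metricUnitField G Z) x : 𝔼⁴ →L[ℝ] 𝔼⁴) : 𝔼⁴ →ₗ[ℝ] 𝔼⁴) (riemAtₗ G x)
      (coordBasis 4) := rfl

/-- A vector of `ℝ⁴` from its coordinates in the standard basis: `(∑ⱼ cⱼ eⱼ)ᵢ = cᵢ`. [folklore] -/
theorem sum_smul_coordBasis_apply (c : Fin 4 → ℝ) (i : Fin 4) :
    (∑ j, c j • (coordBasis 4 j : 𝔼⁴)) i = c i := by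
  have h : (∑ j, c j • (coordBasis 4 j : 𝔼⁴)) = toLp 2 c := by
    conv_rhs => rw [← sum_smul_stdBasis (toLp 2 c)]
  rw [h, PiLp.toLp_apply]

variable {G Z} {V : Set 𝔼⁴} {x : 𝔼⁴}

/-- **The frame arrays of chart data are the coordinate arrays of `MetricCoordMatrix.lean`**:
the Gram matrix of `G_x` in the standard basis is `metricMatrix G`. [folklore] -/
theorem frameGram_coordBasis (x : 𝔼⁴) :
    frameGram (G x).toLinearMap₁₂ (coordBasis 4) = metricMatrix G (ofLp x) := by
  ext i j
  simp [metricMatrix_apply]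

/-- The lowered unit field in the standard basis is `g · unitField` of the matrix formalism.
[folklore] -/
theorem frameCovector_coordBasis (hs : ∀ v w : 𝔼⁴, G x v w = G x w v) :
    frameCovector (G x).toLinearMap₁₂ (metricUnitField G Z x) (coordBasis 4) =
      metricMatrix G (ofLp x) *ᵥ unitField (metricMatrix G) (coordField Z) (ofLp x) := by
  funext a
  rw [unitField_coordField hs, metricMatrix_mulVec hs, frameCovector_apply,
    ContinuousLinearMap.toLinearMap₁₂_apply]

/-- The curvature array in the standard basis is `coordRiemann` of the matrix formalism.
[cite: ONeill1983, Ch. 3, Lemma 3.38] -/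
theorem frameCurv_coordBasis (hG : IsMetricOn G V) (hx : x ∈ V) :
    frameCurv (G x).toLinearMap₁₂ (riemAtₗ G x) (coordBasis 4) = coordRiemann (metricMatrix G) (ofLp x) := by
  funext a c k l
  rw [frameCurv_apply, coordRiemann_metricMatrix hG hx, riemAtₗ_apply,
    ContinuousLinearMap.toLinearMap₁₂_apply]

/-- The lowered covariant differential of the unit field in the standard basis is
`covDerivUnitField` of the matrix formalism. [cite: ONeill1983, Ch. 3, Prop. 3.13] -/
theorem frameEndo_coordBasis (hG : IsMetricOn G V) (hx : x ∈ V)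
    (hu : DifferentiableAt ℝ (metricUnitField G Z) x) :
    frameEndo (G x).toLinearMap₁₂
        ((covDAt G (metricUnitField G Z) x : 𝔼⁴ →L[ℝ] 𝔼⁴) : 𝔼⁴ →ₗ[ℝ] 𝔼⁴) (coordBasis 4) =
      Matrix.of (covDerivUnitField (metricMatrix G) (coordField Z) (ofLp x)) := by
  ext a k
  rw [frameEndo_apply, Matrix.of_apply, covDerivUnitField_coordField hG hx hu,
    ContinuousLinearMap.toLinearMap₁₂_apply, ContinuousLinearMap.coe_coe]

/-- **The coordinate Chern field is the Chern vector of the coordinate arrays**: at a point of `V`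
where the unit field is differentiable,
`(chernCoordField G Z x)ᵢ = chernVec g (g u) Rm (∇u♭) i` with the matrix data of
`ChernTransgression.lean`. [cite: Chern1945, (9)] -/
theorem chernCoordField_apply (hG : IsMetricOn G V) (hx : x ∈ V)
    (hu : DifferentiableAt ℝ (metricUnitField G Z) x) (i : Fin 4) :
    chernCoordField G Z x i = chernVec (metricMatrix G (ofLp x))
      (metricMatrix G (ofLp x) *ᵥ unitField (metricMatrix G) (coordField Z) (ofLp x))
      (coordRiemann (metricMatrix G) (ofLp x))
      (Matrix.of (covDerivUnitField (metricMatrix G) (coordField Z) (ofLp x))) i := by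
  rw [chernCoordField_def, chernVecOfFrame_def, sum_smul_coordBasis_apply, frameGram_coordBasis,
    frameCovector_coordBasis (hG.symm x hx), frameCurv_coordBasis hG hx, frameEndo_coordBasis hG hx hu]

/-- **`√(det g) · X = Π`**: the coordinate Chern field times the density `√det g` is Chern's
coordinate transgression vector density of `ChernTransgression.lean` (`chernTransgression_four`).
[cite: Chern1945, (9)] -/
theorem sqrt_det_mul_chernCoordField (hG : IsMetricOn G V) (hx : x ∈ V)
    (hpos : ∀ v : 𝔼⁴, v ≠ 0 → 0 < G x v v) (hu : DifferentiableAt ℝ (metricUnitField G Z) x)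
    (i : Fin 4) :
    Real.sqrt (metricMatrix G (ofLp x)).det * chernCoordField G Z x i =
      chernTransgression (metricMatrix G) (coordField Z) i (ofLp x) := by
  have hdet : 0 < (metricMatrix G (ofLp x)).det := (posDef_metricMatrix (hG.symm x hx) hpos).det_pos
  rw [chernTransgression_four _ _ _ hdet, chernCoordField_apply hG hx hu]

/-! ### Smoothness of the coordinate Chern field -/

/-- The squared length `G(Z, Z)` of a smooth field is smooth on `V`. [folklore] -/
theorem contDiffAt_metricSq (hG : IsMetricOn G V) (hx : x ∈ V) (hZ : ContDiffOn ℝ ∞ Z V) :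
    ContDiffAt ℝ ∞ (fun y ↦ G y (Z y) (Z y)) x := by
  have hZa : ContDiffAt ℝ ∞ Z x := (hZ x hx).contDiffAt (hG.mem_nhds hx)
  exact ((hG.contDiffAt hx).clm_apply hZa).clm_apply hZa

/-- **The unit field `û = Z/|Z|_G` is smooth where `G(Z,Z) > 0`.** [cite: Chern1944, (11)] -/
theorem contDiffAt_metricUnitField (hG : IsMetricOn G V) (hx : x ∈ V) (hZ : ContDiffOn ℝ ∞ Z V)
    (hq : 0 < G x (Z x) (Z x)) : ContDiffAt ℝ ∞ (metricUnitField G Z) x := by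
  have hZa : ContDiffAt ℝ ∞ Z x := (hZ x hx).contDiffAt (hG.mem_nhds hx)
  have h1 : ContDiffAt ℝ ∞ (fun y ↦ (Real.sqrt (G y (Z y) (Z y)))⁻¹) x :=
    ((contDiffAt_metricSq hG hx hZ).sqrt hq.ne').inv (Real.sqrt_pos.2 hq).ne'
  exact h1.smul hZa

/-- The covariant differential `∇û` of the unit field is smooth where `G(Z,Z) > 0`. [folklore] -/
theorem contDiffAt_covDAt_metricUnitField (hG : IsMetricOn G V) (hx : x ∈ V)
    (hZ : ContDiffOn ℝ ∞ Z V) (hq : 0 < G x (Z x) (Z x)) :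
    ContDiffAt ℝ ∞ (fun y ↦ covDAt G (metricUnitField G Z) y) x := by
  have hu := contDiffAt_metricUnitField hG hx hZ hq
  have hDu : ContDiffAt ℝ ∞ (fderiv ℝ (metricUnitField G Z)) x := hu.fderiv_right (m := ∞) (by simp)
  simp only [covDAt]
  exact hDu.add ((hG.contDiffAt_chrAt hx).clm_apply hu)

/-- Entries of the Gram matrix of `G` in the standard basis are smooth. [folklore] -/
theorem contDiffAt_frameGram_entry (hG : IsMetricOn G V) (hx : x ∈ V) (i j : Fin 4) :
    ContDiffAt ℝ ∞ (fun y ↦ frameGram (G y).toLinearMap₁₂ (coordBasis 4) i j) x := by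
  simp only [frameGram_apply, ContinuousLinearMap.toLinearMap₁₂_apply]
  exact ((hG.contDiffAt hx).clm_apply contDiffAt_const).clm_apply contDiffAt_const

/-- The determinant of a `4 × 4` matrix of smooth functions is smooth. [folklore] -/
theorem contDiffAt_det_of_entries {F : Type*} [NormedAddCommGroup F] [NormedSpace ℝ F]
    {A : F → Matrix (Fin 4) (Fin 4) ℝ} {x : F} (hA : ∀ i j, ContDiffAt ℝ ∞ (fun y ↦ A y i j) x) :
    ContDiffAt ℝ ∞ (fun y ↦ (A y).det) x := by
  simp only [Matrix.det_apply']
  refine ContDiffAt.sum fun σ _ ↦ ?_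
  exact contDiffAt_const.mul (contDiffAt_prod fun i _ ↦ hA _ _)

/-- The covector entries `u♭_a` are smooth where `G(Z,Z) > 0`. [folklore] -/
theorem contDiffAt_frameCovector_entry (hG : IsMetricOn G V) (hx : x ∈ V)
    (hZ : ContDiffOn ℝ ∞ Z V) (hq : 0 < G x (Z x) (Z x)) (a : Fin 4) :
    ContDiffAt ℝ ∞ (fun y ↦ frameCovector (G y).toLinearMap₁₂ (metricUnitField G Z y)
      (coordBasis 4) a) x := by
  simp only [frameCovector_apply, ContinuousLinearMap.toLinearMap₁₂_apply]
  exact ((hG.contDiffAt hx).clm_apply (contDiffAt_metricUnitField hG hx hZ hq)).clm_apply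
    contDiffAt_const

/-- The entries `N_{ak} = (∇ₖu)ₐ` are smooth where `G(Z,Z) > 0`. [folklore] -/
theorem contDiffAt_frameEndo_entry (hG : IsMetricOn G V) (hx : x ∈ V)
    (hZ : ContDiffOn ℝ ∞ Z V) (hq : 0 < G x (Z x) (Z x)) (a k : Fin 4) :
    ContDiffAt ℝ ∞ (fun y ↦ frameEndo (G y).toLinearMap₁₂
      ((covDAt G (metricUnitField G Z) y : 𝔼⁴ →L[ℝ] 𝔼⁴) : 𝔼⁴ →ₗ[ℝ] 𝔼⁴) (coordBasis 4) a k) x := by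
  simp only [frameEndo_apply, ContinuousLinearMap.toLinearMap₁₂_apply, ContinuousLinearMap.coe_coe]
  exact ((hG.contDiffAt hx).clm_apply
    ((contDiffAt_covDAt_metricUnitField hG hx hZ hq).clm_apply contDiffAt_const)).clm_apply
    contDiffAt_const

/-- The curvature entries `W_{ackl}` are smooth on `V`. [folklore] -/
theorem contDiffAt_frameCurv_entry (hG : IsMetricOn G V) (hx : x ∈ V) (a c k l : Fin 4) :
    ContDiffAt ℝ ∞ (fun y ↦ frameCurv (G y).toLinearMap₁₂ (riemAtₗ G y) (coordBasis 4) a c k l) x := by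
  simp only [frameCurv_apply, riemAtₗ_apply, ContinuousLinearMap.toLinearMap₁₂_apply]
  exact ((hG.contDiffAt hx).clm_apply
    ((hG.contDiffAt_riemAt hx _ _).clm_apply contDiffAt_const)).clm_apply contDiffAt_const

/-- **Smoothness of the Chern vector of smooth arrays**: if the entries of `g, u♭, W, N` are smooth
functions and `det g ≠ 0` at the point, every component of `chernVec g u♭ W N` is smooth there
(a rational function of the entries). [cite: Chern1945, (9)] -/
theorem contDiffAt_chernVec {F : Type*} [NormedAddCommGroup F] [NormedSpace ℝ F] {x : F}
    {g : F → Matrix (Fin 4) (Fin 4) ℝ} {uL : F → Fin 4 → ℝ}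
    {W : F → Fin 4 → Fin 4 → Fin 4 → Fin 4 → ℝ} {N : F → Matrix (Fin 4) (Fin 4) ℝ}
    (hg : ∀ i j, ContDiffAt ℝ ∞ (fun y ↦ g y i j) x) (hdet : (g x).det ≠ 0)
    (huL : ∀ a, ContDiffAt ℝ ∞ (fun y ↦ uL y a) x)
    (hW : ∀ a c k l, ContDiffAt ℝ ∞ (fun y ↦ W y a c k l) x)
    (hN : ∀ a k, ContDiffAt ℝ ∞ (fun y ↦ N y a k) x) (i : Fin 4) :
    ContDiffAt ℝ ∞ (fun y ↦ chernVec (g y) (uL y) (W y) (N y) i) x := by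
  have h0 : ContDiffAt ℝ ∞ (fun y ↦ chernSum₀ (uL y) (N y) i) x := by
    simp only [chernSum₀_eq_sum]
    refine ContDiffAt.sum fun σ _ ↦ ContDiffAt.sum fun τ _ ↦ ?_
    split_ifs
    · exact (contDiffAt_const.mul contDiffAt_const).mul
        ((huL _).mul (((hN _ _).mul (hN _ _)).mul (hN _ _)))
    · exact contDiffAt_const
  have h1 : ContDiffAt ℝ ∞ (fun y ↦ chernSum₁ (uL y) (W y) (N y) i) x := by
    simp only [chernSum₁_eq_sum]
    refine ContDiffAt.sum fun σ _ ↦ ContDiffAt.sum fun τ _ ↦ ?_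
    split_ifs
    · exact (contDiffAt_const.mul contDiffAt_const).mul
        (((huL _).mul (hW _ _ _ _)).mul (hN _ _))
    · exact contDiffAt_const
  simp only [chernVec_apply]
  exact (((contDiffAt_det_of_entries hg).inv hdet).mul
    ((contDiffAt_const.mul h0).add (contDiffAt_const.mul h1))).neg

/-- **The coordinate Chern field is smooth where `Z ≠ 0`** (for `G` a metric on `V`, positive
definite, and `Z` smooth on `V`). [cite: Chern1945, (9)] -/
theorem contDiffAt_chernCoordField (hG : IsMetricOn G V) (hx : x ∈ V)
    (hpos : ∀ v : 𝔼⁴, v ≠ 0 → 0 < G x v v) (hZ : ContDiffOn ℝ ∞ Z V) (hZx : Z x ≠ 0) :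
    ContDiffAt ℝ ∞ (chernCoordField G Z) x := by
  have hq : 0 < G x (Z x) (Z x) := hpos _ hZx
  have hdet : (frameGram (G x).toLinearMap₁₂ (coordBasis 4)).det ≠ 0 := by
    rw [frameGram_coordBasis]
    exact (posDef_metricMatrix (hG.symm x hx) hpos).det_pos.ne'
  have hcomp : ∀ i, ContDiffAt ℝ ∞ (fun y ↦ chernCoordField G Z y i) x := fun i ↦ by
    simp only [chernCoordField_def, chernVecOfFrame_def, sum_smul_coordBasis_apply]
    exact contDiffAt_chernVec (contDiffAt_frameGram_entry hG hx) hdet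
      (contDiffAt_frameCovector_entry hG hx hZ hq) (contDiffAt_frameCurv_entry hG hx)
      (contDiffAt_frameEndo_entry hG hx hZ hq) i
  have h : chernCoordField G Z = fun y ↦ ∑ i, chernCoordField G Z y i • (coordBasis 4 i : 𝔼⁴) := by
    funext y
    exact (sum_smul_stdBasis (chernCoordField G Z y)).symm
  rw [h]
  exact ContDiffAt.sum fun i _ ↦ (hcomp i).smul contDiffAt_const

end Coord

/-! ### The unit field of a vector field -/

section UnitSection

variable {E : Type*} [NormedAddCommGroup E] [NormedSpace ℝ E] {H : Type*} [TopologicalSpace H]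
  {I : ModelWithCorners ℝ E H} {M : Type*} [TopologicalSpace M] [ChartedSpace H M]
  [IsManifold I ∞ M] (g : PseudoRiemannianMetric I ∞ E (TangentSpace I : M → Type _))

/-- **The unit field** `u = Y/|Y|_g` of a vector field `Y` (junk value where `g(Y,Y) ≤ 0`, by
`√` and `0⁻¹ = 0`); off the zeros of `Y` on a Riemannian manifold this is the section of the unit
sphere bundle by which Chern pulls back his transgression form (Chern 1944, §2). [cite: Chern1944, §2] -/
def unitSection (Y : Π x : M, TangentSpace I x) (x : M) : TangentSpace I x :=
  (Real.sqrt (g.val x (Y x) (Y x)))⁻¹ • Y x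

/-- Unfolding lemma for `unitSection`. [cite: Chern1944, §2] -/
theorem unitSection_apply (Y : Π x : M, TangentSpace I x) (x : M) :
    unitSection g Y x = (Real.sqrt (g.val x (Y x) (Y x)))⁻¹ • Y x := rfl

end UnitSection

/-! ### The Chern field of a metric and a vector field on a `4`-manifold -/

section Manifold

/-- Local notation for the model space `ℝ⁴` with its Euclidean structure. -/
local notation "𝔼⁴" => EuclideanSpace ℝ (Fin 4)

variable {M : Type*} [TopologicalSpace M] [ChartedSpace (EuclideanSpace ℝ (Fin 4)) M]
  [IsManifold (𝓡 4) ∞ M]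
  (g : PseudoRiemannianMetric (𝓡 4) ∞ (EuclideanSpace ℝ (Fin 4)) (TangentSpace (𝓡 4) : M → Type _))

/-- A vector field as a map into the tangent bundle `TM` (the form in which Mathlib states the
smoothness of sections; the `T%` elaborator is not available for the concrete model `𝓡 4`).
[folklore] -/
abbrev secTM (Y : Π x : M, TangentSpace (𝓡 4) x) : M → TangentBundle (𝓡 4) M :=
  fun y ↦ TotalSpace.mk' (EuclideanSpace ℝ (Fin 4)) y (Y y)

/-- **The unit field in a chart** is the coordinate unit field of the representatives:
`(u)^ = û = Ŷ/√Ĝ(Ŷ,Ŷ)` (`metricUnitField`). [cite: Chern1944, (11)] -/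
theorem vectorRep_unitSection (x₁ : M) (Y : Π x : M, TangentSpace (𝓡 4) x) {e : 𝔼⁴}
    (he : e ∈ (extChartAt (𝓡 4) x₁).target) :
    vectorRep (𝓡 4) x₁ (unitSection g Y) e =
      metricUnitField (metricRep (𝓡 4) g x₁) (vectorRep (𝓡 4) x₁ Y) e := by
  rw [unitVec_apply, metricRep_vectorRep_self g x₁ Y he, vectorRep_apply, vectorRep_apply,
    unitSection_apply, map_smul]
  rfl

/-- The standard basis of a tangent space `T_x M` under Mathlib's identification `T_x M = ℝ⁴`
(the frame `∂ᵢ` of the preferred chart at `x`; any other basis gives the same Chern vector,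
`chernVecOfFrame_eq_of_basis`). [folklore] -/
def tangentCoordBasis (x : M) : Module.Basis (Fin 4) ℝ (TangentSpace (𝓡 4) x) := coordBasis 4

variable [g.HasLeviCivita]

/-- **The Chern field** `X` of the metric `g` and the vector field `Y` on a `4`-manifold: at `x`,
the Chern vector (`chernVecOfFrame`) of the intrinsic data `(g_x, u_x, R_x, (∇u)_x)`, `u = Y/|Y|_g`
the unit field, `R_x(X,Y)Z` the Riemann curvature endomorphism and `∇u` the Levi-Civita covariant
differential of `u`. Equivalently `ι_X dV_g = u^*Π` with `Π` Chern's transgression `3`-form on the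
unit sphere bundle normalised by `dΠ = Pf(Ω)` (Chern 1944, §1; Chern 1945, (9)); in a chart it is
the coordinate Chern field of the components (`vectorRep_chernField`), so it is smooth off the
zeros of `Y` (`contMDiffAt_chernField`) and its divergence there is the Euler form
(`vectorDivergence_chernField`). Junk at the zeros of `Y`. [cite: Chern1945, (9)] [cite: Chern1944, §1] -/
def chernField (Y : Π x : M, TangentSpace (𝓡 4) x) (x : M) : TangentSpace (𝓡 4) x :=
  chernVecOfFrame (g.toBilinForm x) (unitSection g Y x)
    ((g.leviCivita (unitSection g Y) x : TangentSpace (𝓡 4) x →L[ℝ] TangentSpace (𝓡 4) x) :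
      TangentSpace (𝓡 4) x →ₗ[ℝ] TangentSpace (𝓡 4) x)
    (trilinOfCLM (g.riemann x)) (tangentCoordBasis x)

/-- Unfolding lemma for `chernField`. [cite: Chern1945, (9)] -/
theorem chernField_def (Y : Π x : M, TangentSpace (𝓡 4) x) (x : M) : chernField g Y x =
    chernVecOfFrame (g.toBilinForm x) (unitSection g Y x)
      ((g.leviCivita (unitSection g Y) x : TangentSpace (𝓡 4) x →L[ℝ] TangentSpace (𝓡 4) x) :
        TangentSpace (𝓡 4) x →ₗ[ℝ] TangentSpace (𝓡 4) x)
      (trilinOfCLM (g.riemann x)) (tangentCoordBasis x) := rfl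

omit [g.HasLeviCivita] in
/-- The metric read in a chart of a Riemannian metric is positive definite on the chart target.
[folklore] -/
theorem metricRep_pos (hg : g.IsRiemannian) (x₁ : M) {e : 𝔼⁴}
    (he : e ∈ (extChartAt (𝓡 4) x₁).target) (v : 𝔼⁴) (hv : v ≠ 0) :
    0 < metricRep (𝓡 4) g x₁ e v v := by
  have h := chartPullback_pos (I := 𝓡 4) g x₁ ⟨e, he⟩ (fun w hw ↦ hg _ w hw) v hv
  rwa [val_chartPullback_eq_metricRep] at h

omit [g.HasLeviCivita] in
/-- **The unit field is smooth off the zeros of the field** (Riemannian metric, smooth field):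
chart criterion with the smooth representative `û` (`contDiffAt_metricUnitField`).
[cite: Chern1944, §2] -/
theorem contMDiffAt_unitSection (hg : g.IsRiemannian) {Y : Π x : M, TangentSpace (𝓡 4) x}
    (x₁ : M) (hY : ContMDiffOn (𝓡 4) ((𝓡 4).prod 𝓘(ℝ, 𝔼⁴)) ∞ (secTM Y)
      (chartAt (EuclideanSpace ℝ (Fin 4)) x₁).source) {y : M}
    (hy : y ∈ (chartAt (EuclideanSpace ℝ (Fin 4)) x₁).source) (hYy : Y y ≠ 0) :
    ContMDiffAt (𝓡 4) ((𝓡 4).prod 𝓘(ℝ, 𝔼⁴)) ∞ (secTM (unitSection g Y)) y := by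
  set φ := extChartAt (𝓡 4) x₁ with hφ
  have hys : y ∈ φ.source := by rwa [hφ, extChartAt_source]
  have hyt : φ y ∈ φ.target := φ.map_source hys
  have hĜ : IsMetricOn (metricRep (𝓡 4) g x₁) φ.target :=
    OpensChart.isMetricOn_repr (val_chartPullback_eq_metricRep g x₁)
  have hŶ : ContDiffOn ℝ ∞ (vectorRep (𝓡 4) x₁ Y) φ.target := contDiffOn_vectorRep x₁ hY
  have hq : 0 < metricRep (𝓡 4) g x₁ (φ y) (vectorRep (𝓡 4) x₁ Y (φ y)) (vectorRep (𝓡 4) x₁ Y (φ y)) := by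
    rw [metricRep_vectorRep_self g x₁ Y hyt, φ.left_inv hys]
    exact hg y (Y y) hYy
  refine contMDiffAt_section_of_vectorRep x₁ hy (contDiffAt_metricUnitField hĜ hyt hŶ hq) ?_
  filter_upwards [(chartAt (EuclideanSpace ℝ (Fin 4)) x₁).open_source.mem_nhds hy] with z hz
  have hzs : z ∈ φ.source := by rw [hφ, extChartAt_source]; exact hz
  exact vectorRep_unitSection g x₁ Y (φ.map_source hzs)

/-- `covDAt` depends only on the germ of the field at the point. [folklore] -/
theorem _root_.Literature.Geometry.Lorentzian.MetricCoord.covDAt_congr_of_eventuallyEq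
    {F : Type*} [NormedAddCommGroup F] [NormedSpace ℝ F] {G : F → F →L[ℝ] F →L[ℝ] ℝ}
    {Z Z' : F → F} {x : F} (h : Z =ᶠ[𝓝 x] Z') : covDAt G Z x = covDAt G Z' x := by
  simp only [covDAt, h.fderiv_eq, h.eq_of_nhds]

set_option backward.isDefEq.respectTransparency false in
/-- **The Chern field in a chart is the coordinate Chern field of the components.** For a
Riemannian metric `g`, a vector field `Y` smooth on the chart domain of `x₁` and a point `u` of the
chart target at which `Y ≠ 0`,
`(X)^_u = chernCoordField Ĝ Ŷ u` with `Ĝ = metricRep g x₁`, `Ŷ = vectorRep Y`.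
Proof: the differential `dΦ_u` of the inverse chart `Φ` transports the data — `Ĝ_u = Φ^*g`
(`val_chartPullback_apply`), `û = dΦ⁻¹ u` (`vectorRep_unitSection`), `∇^{Ĝ} û = dΦ⁻¹ ∘ ∇^g u ∘ dΦ`
(`leviCivita_comap_mpullback_apply`, `leviCivita_eq_covDAt`) and `R^{Ĝ} = dΦ⁻¹ R^g(dΦ·, dΦ·) dΦ·`
(`riemann_comap_apply`, `riemann_eq_riemAt`) — and the Chern vector is natural
(`chernVecOfFrame_map`). This is Chern's "`Π` is intrinsic" (1944, §1). [cite: Chern1944, §1]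
[cite: ONeill1983, Ch. 3, Prop. 3.59] -/
theorem vectorRep_chernField (hg : g.IsRiemannian) (x₁ : M) {Y : Π x : M, TangentSpace (𝓡 4) x}
    (hY : ContMDiffOn (𝓡 4) ((𝓡 4).prod 𝓘(ℝ, 𝔼⁴)) ∞ (secTM Y)
      (chartAt (EuclideanSpace ℝ (Fin 4)) x₁).source)
    (u : chartTarget (𝓡 4) x₁) (hYu : Y (chartInv (𝓡 4) x₁ u) ≠ 0) :
    vectorRep (𝓡 4) x₁ (chernField g Y) u =
      chernCoordField (metricRep (𝓡 4) g x₁) (vectorRep (𝓡 4) x₁ Y) u := by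
  haveI := (chartPullback (𝓡 4) g x₁).hasLeviCivita
  set x := chartInv (𝓡 4) x₁ u with hx
  set Ĝ := metricRep (𝓡 4) g x₁ with hĜ
  set Ŷ := vectorRep (𝓡 4) x₁ Y with hŶ
  have hxs : x ∈ (chartAt (EuclideanSpace ℝ (Fin 4)) x₁).source := chartInv_mem_source x₁ u
  have hĜm : IsMetricOn Ĝ (chartTarget (𝓡 4) x₁ : Set 𝔼⁴) :=
    OpensChart.isMetricOn_repr (val_chartPullback_eq_metricRep g x₁)
  have hŶs : ContDiffOn ℝ ∞ Ŷ (chartTarget (𝓡 4) x₁ : Set 𝔼⁴) := contDiffOn_vectorRep x₁ hY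
  -- the differential of the inverse chart as a linear equivalence `T_u ℝ⁴ ≃ T_x M`
  set eD := mfderivEquivOfInjective (I := 𝓡 4) (I' := 𝓘(ℝ, 𝔼⁴)) (chartInv (𝓡 4) x₁) u
    (injective_mfderiv_chartInv x₁ u) rfl with heD
  have heDa : ∀ v, eD v = mfderiv 𝓘(ℝ, 𝔼⁴) (𝓡 4) (chartInv (𝓡 4) x₁) u v := fun v ↦ rfl
  have hinv : (mfderiv 𝓘(ℝ, 𝔼⁴) (𝓡 4) (chartInv (𝓡 4) x₁) u).IsInvertible :=
    isInvertible_mfderiv_of_injective rfl (injective_mfderiv_chartInv x₁ u)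
  have heDs : ∀ w, eD.symm w = (mfderiv 𝓘(ℝ, 𝔼⁴) (𝓡 4) (chartInv (𝓡 4) x₁) u).inverse w := by
    intro w
    apply eD.injective
    rw [LinearEquiv.apply_symm_apply, heDa, hinv.self_apply_inverse]
  -- (0) the unit field: smooth at `x`, represented by `û`
  have hus := contMDiffAt_unitSection g hg x₁ hY hxs hYu
  have hud : MDifferentiableAt (𝓡 4) ((𝓡 4).prod 𝓘(ℝ, 𝔼⁴)) (secTM (unitSection g Y))
      (chartInv (𝓡 4) x₁ u) := hus.mdifferentiableAt (by simp)
  have hq : 0 < Ĝ u (Ŷ u) (Ŷ u) := by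
    rw [hĜ, hŶ, metricRep_vectorRep_self g x₁ Y u.2]
    exact hg _ _ hYu
  have hûs : ContDiffAt ℝ ∞ (metricUnitField Ĝ Ŷ) u := contDiffAt_metricUnitField hĜm u.2 hŶs hq
  have hrepu : vectorRep (𝓡 4) x₁ (unitSection g Y) =ᶠ[𝓝 (u : 𝔼⁴)] metricUnitField Ĝ Ŷ := by
    filter_upwards [(isOpen_extChartAt_target x₁).mem_nhds u.2] with e he
    exact vectorRep_unitSection g x₁ Y he
  have hrepud : DifferentiableAt ℝ (vectorRep (𝓡 4) x₁ (unitSection g Y)) u :=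
    (hûs.differentiableAt (by simp)).congr_of_eventuallyEq hrepu
  -- (1) the metric: `Ĝ_u(v, w) = g_x(dΦ v, dΦ w)`
  have hB : ∀ v w, (Ĝ u).toLinearMap₁₂ v w = g.toBilinForm x (eD.symm.symm v) (eD.symm.symm w) := by
    intro v w
    rw [ContinuousLinearMap.toLinearMap₁₂_apply, LinearEquiv.symm_symm,
      PseudoRiemannianMetric.toBilinForm_apply, heDa, heDa, hĜ, ← val_chartPullback_eq_metricRep g x₁ u]
    rfl
  -- (2) the unit vector: `û u = dΦ⁻¹ (u_x)`
  have hu : metricUnitField Ĝ Ŷ u = eD.symm (unitSection g Y x) := by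
    rw [heDs, inverse_mfderiv_chartInv, ← vectorRep_unitSection g x₁ Y u.2, vectorRep_apply]
    rfl
  -- (3) the covariant differential: `∇^Ĝ û|_u = dΦ⁻¹ ∘ ∇^g u|_x ∘ dΦ`
  have hS : ∀ w, ((covDAt Ĝ (metricUnitField Ĝ Ŷ) u : 𝔼⁴ →L[ℝ] 𝔼⁴) : 𝔼⁴ →ₗ[ℝ] 𝔼⁴) w =
      eD.symm (((g.leviCivita (unitSection g Y) x : TangentSpace (𝓡 4) x →L[ℝ]
        TangentSpace (𝓡 4) x) : TangentSpace (𝓡 4) x →ₗ[ℝ] TangentSpace (𝓡 4) x)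
        (eD.symm.symm w)) := by
    intro w
    rw [LinearEquiv.symm_symm, ContinuousLinearMap.coe_coe, ContinuousLinearMap.coe_coe, heDs, heDa,
      ← g.leviCivita_comap_mpullback_apply contMDiff_pullbackBilin_holds (contMDiff_chartInv x₁)
        (injective_mfderiv_chartInv x₁) rfl hud w,
      ← covDAt_congr_of_eventuallyEq hrepu]
    have h := leviCivita_eq_covDAt (val_chartPullback_eq_metricRep g x₁) u
      (W := mpullback 𝓘(ℝ, 𝔼⁴) (𝓡 4) (chartInv (𝓡 4) x₁) (unitSection g Y))
      (fun y ↦ mpullback_chartInv_apply x₁ (unitSection g Y) y) hrepud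
    exact (DFunLike.congr_fun h w).symm
  -- (4) the curvature: `R^Ĝ_u(X,Y)Z = dΦ⁻¹ R^g_x(dΦ X, dΦ Y) dΦ Z`
  have hR : ∀ X₀ Y₀ Z₀, riemAtₗ Ĝ u X₀ Y₀ Z₀ =
      eD.symm (trilinOfCLM (g.riemann x) (eD.symm.symm X₀) (eD.symm.symm Y₀) (eD.symm.symm Z₀)) := by
    intro X₀ Y₀ Z₀
    rw [riemAtₗ_apply, LinearEquiv.symm_symm, trilinOfCLM_apply, heDs, heDa, heDa, heDa,
      ← g.riemann_comap_apply contMDiff_pullbackBilin_holds (contMDiff_chartInv x₁)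
        (injective_mfderiv_chartInv x₁) rfl u X₀ Y₀ Z₀]
    exact (OpensChart.riemann_eq_riemAt (val_chartPullback_eq_metricRep g x₁) u X₀ Y₀ Z₀).symm
  -- assemble with the naturality of the Chern vector
  have hmap := chernVecOfFrame_map (g.toBilinForm x) (unitSection g Y x)
    ((g.leviCivita (unitSection g Y) x : TangentSpace (𝓡 4) x →L[ℝ] TangentSpace (𝓡 4) x) :
      TangentSpace (𝓡 4) x →ₗ[ℝ] TangentSpace (𝓡 4) x)
    (trilinOfCLM (g.riemann x)) (tangentCoordBasis x) eD.symm (Ĝ u).toLinearMap₁₂ hB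
    ((covDAt Ĝ (metricUnitField Ĝ Ŷ) u : 𝔼⁴ →L[ℝ] 𝔼⁴) : 𝔼⁴ →ₗ[ℝ] 𝔼⁴) hS (riemAtₗ Ĝ u) hR
    (coordBasis 4)
  rw [← hu, ← chernCoordField_def, ← chernField_def, heDs, inverse_mfderiv_chartInv] at hmap
  rw [hmap, vectorRep_apply]
  rfl

/-- **The Chern field is smooth off the zeros of the field** (Riemannian metric, smooth field):
its chart representative is the smooth coordinate Chern field (`vectorRep_chernField`,
`contDiffAt_chernCoordField`). [cite: Chern1945, (9)] -/
theorem contMDiffAt_chernField (hg : g.IsRiemannian) {Y : Π x : M, TangentSpace (𝓡 4) x} {x : M}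
    (hY : ContMDiffOn (𝓡 4) ((𝓡 4).prod 𝓘(ℝ, 𝔼⁴)) ∞ (secTM Y)
      (chartAt (EuclideanSpace ℝ (Fin 4)) x).source) (hx : Y x ≠ 0) :
    ContMDiffAt (𝓡 4) ((𝓡 4).prod 𝓘(ℝ, 𝔼⁴)) ∞ (secTM (chernField g Y)) x := by
  set φ := extChartAt (𝓡 4) x with hφ
  have hxs : x ∈ (chartAt (EuclideanSpace ℝ (Fin 4)) x).source := mem_chart_source _ x
  have hct : φ x ∈ φ.target := mem_extChartAt_target x
  have hĜ : IsMetricOn (metricRep (𝓡 4) g x) φ.target :=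
    OpensChart.isMetricOn_repr (val_chartPullback_eq_metricRep g x)
  have hŶ : ContDiffOn ℝ ∞ (vectorRep (𝓡 4) x Y) φ.target := contDiffOn_vectorRep x hY
  have hŶ0 : vectorRep (𝓡 4) x Y (φ x) ≠ 0 := by
    rw [vectorRep_apply, hφ, extChartAt_to_inv x]
    intro h0
    exact hx ((isInvertible_mfderiv_extChartAt (mem_extChartAt_source x)).injective
      (h0.trans (map_zero _).symm))
  have hŶc : ContinuousAt (vectorRep (𝓡 4) x Y) (φ x) :=
    hŶ.continuousOn.continuousAt ((isOpen_extChartAt_target x).mem_nhds hct)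
  have hev : ∀ᶠ z in 𝓝 x, vectorRep (𝓡 4) x Y (φ z) ≠ 0 :=
    (continuousAt_extChartAt x).eventually (hŶc.eventually_ne hŶ0)
  refine contMDiffAt_section_of_vectorRep x hxs
    (contDiffAt_chernCoordField hĜ hct (metricRep_pos g hg x hct) hŶ hŶ0) ?_
  filter_upwards [hev, (chartAt (EuclideanSpace ℝ (Fin 4)) x).open_source.mem_nhds hxs] with z hz hzs
  have hzs' : z ∈ φ.source := by rwa [hφ, extChartAt_source]
  have hzt : φ z ∈ φ.target := φ.map_source hzs'
  have hYz : Y (chartInv (𝓡 4) x ⟨φ z, hzt⟩) ≠ 0 := by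
    rw [chartInv_extChartAt x hzs]
    intro h0
    apply hz
    rw [vectorRep_apply, φ.left_inv hzs', h0]
    exact map_zero _
  exact vectorRep_chernField g hg x hY ⟨φ z, hzt⟩ hYz

/-! ### The Pfaffian in a chart and the Euler form -/

/-- **The Pfaffian scalar of chart data is Chern's Euler density over `√det g`**:
`pfaffOfFrame Ĝ_x R_x (eᵢ) = (32 det g)⁻¹ · pfaffPair Rm Rm` with the matrix data of
`ChernTransgression.lean` (`eulerDensity_four`: `E = (32 √det g)⁻¹ pfaffPair Rm Rm`).
[cite: Chern1945, (10)] -/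
theorem pfaffOfFrame_coordBasis {G : 𝔼⁴ → 𝔼⁴ →L[ℝ] 𝔼⁴ →L[ℝ] ℝ} {V : Set 𝔼⁴} {x : 𝔼⁴}
    (hG : IsMetricOn G V) (hx : x ∈ V) :
    pfaffOfFrame (G x).toLinearMap₁₂ (riemAtₗ G x) (coordBasis 4) =
      (32 * (metricMatrix G (ofLp x)).det)⁻¹ *
        pfaffPair (coordRiemann (metricMatrix G) (ofLp x)) (coordRiemann (metricMatrix G) (ofLp x)) := by
  rw [pfaffOfFrame_def, frameCurv_coordBasis hG hx]
  have h : frameGram (G x).toLinearMap₁₂ (coordBasis 4 : Fin 4 → 𝔼⁴) = metricMatrix G (ofLp x) :=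
    frameGram_coordBasis x
  rw [h]

/-- **The Pfaffian scalar read in a chart is the Pfaffian scalar of the manifold data**: for `u`
in the chart target at `x₁` and `x = Φ u`,
`pfaffOfFrame Ĝ_u R^Ĝ_u = pfaffOfFrame g_x R^g_x` (naturality of `R` under the local isometry `Φ`,
`riemann_comap_apply`, `riemann_eq_riemAt`, and `pfaffOfFrame_map`). [cite: ONeill1983, Ch. 3, Prop. 3.59] -/
theorem pfaffOfFrame_metricRep (x₁ : M) (u : chartTarget (𝓡 4) x₁) :
    pfaffOfFrame (metricRep (𝓡 4) g x₁ u).toLinearMap₁₂ (riemAtₗ (metricRep (𝓡 4) g x₁) u)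
        (coordBasis 4) =
      pfaffOfFrame (g.toBilinForm (chartInv (𝓡 4) x₁ u)) (trilinOfCLM (g.riemann (chartInv (𝓡 4) x₁ u)))
        (tangentCoordBasis (chartInv (𝓡 4) x₁ u)) := by
  haveI := (chartPullback (𝓡 4) g x₁).hasLeviCivita
  set x := chartInv (𝓡 4) x₁ u with hx
  set Ĝ := metricRep (𝓡 4) g x₁ with hĜ
  set eD := mfderivEquivOfInjective (I := 𝓡 4) (I' := 𝓘(ℝ, 𝔼⁴)) (chartInv (𝓡 4) x₁) u
    (injective_mfderiv_chartInv x₁ u) rfl with heD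
  have heDa : ∀ v, eD v = mfderiv 𝓘(ℝ, 𝔼⁴) (𝓡 4) (chartInv (𝓡 4) x₁) u v := fun v ↦ rfl
  have hinv : (mfderiv 𝓘(ℝ, 𝔼⁴) (𝓡 4) (chartInv (𝓡 4) x₁) u).IsInvertible :=
    isInvertible_mfderiv_of_injective rfl (injective_mfderiv_chartInv x₁ u)
  have heDs : ∀ w, eD.symm w = (mfderiv 𝓘(ℝ, 𝔼⁴) (𝓡 4) (chartInv (𝓡 4) x₁) u).inverse w := by
    intro w
    apply eD.injective
    rw [LinearEquiv.apply_symm_apply, heDa, hinv.self_apply_inverse]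
  have hB : ∀ v w, (Ĝ u).toLinearMap₁₂ v w = g.toBilinForm x (eD.symm.symm v) (eD.symm.symm w) := by
    intro v w
    rw [ContinuousLinearMap.toLinearMap₁₂_apply, LinearEquiv.symm_symm,
      PseudoRiemannianMetric.toBilinForm_apply, heDa, heDa, hĜ, ← val_chartPullback_eq_metricRep g x₁ u]
    rfl
  have hR : ∀ X₀ Y₀ Z₀, riemAtₗ Ĝ u X₀ Y₀ Z₀ =
      eD.symm (trilinOfCLM (g.riemann x) (eD.symm.symm X₀) (eD.symm.symm Y₀) (eD.symm.symm Z₀)) := by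
    intro X₀ Y₀ Z₀
    rw [riemAtₗ_apply, LinearEquiv.symm_symm, trilinOfCLM_apply, heDs, heDa, heDa, heDa,
      ← g.riemann_comap_apply contMDiff_pullbackBilin_holds (contMDiff_chartInv x₁)
        (injective_mfderiv_chartInv x₁) rfl u X₀ Y₀ Z₀]
    exact (OpensChart.riemann_eq_riemAt (val_chartPullback_eq_metricRep g x₁) u X₀ Y₀ Z₀).symm
  exact pfaffOfFrame_map (g.toBilinForm x) (trilinOfCLM (g.riemann x)) (tangentCoordBasis x) eD.symm
    (Ĝ u).toLinearMap₁₂ hB (riemAtₗ Ĝ u) hR (coordBasis 4)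

/-- **The Euler form is the Pfaffian scalar of the manifold data**: on a Riemannian `4`-manifold,
`eulerForm g x = pfaffOfFrame g_x R_x (any basis)` — in an orthonormal basis `b` the Gram matrix is
`1` and `pfaffPair` of the curvature array is `pfaffianSumFour (Rm ∘ b)` (`pfaffPair_eq_pfaffianSumFour`),
i.e. `32 · eulerFormFrame` (`EulerFormFour.lean`). [cite: Chern1945, (10)] -/
theorem eulerForm_eq_pfaffOfFrame (hg : g.IsRiemannian) (x : M) :
    g.eulerForm x = pfaffOfFrame (g.toBilinForm x) (trilinOfCLM (g.riemann x)) (tangentCoordBasis x) := by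
  obtain ⟨b, hb⟩ := g.exists_basis_isOrthonormalFrame (x := x) (fun v hv ↦ hg x v hv)
    finrank_euclideanSpace_fin
  rw [g.eulerForm_eq_eulerFormFrame (WithTop.coe_le_coe.mpr le_top) finrank_euclideanSpace_fin hb,
    pfaffOfFrame_eq_of_basis (g.toBilinForm x) (trilinOfCLM (g.riemann x)) b (tangentCoordBasis x),
    pfaffOfFrame_def, eulerFormFrame]
  have hG : frameGram (g.toBilinForm x) b = 1 := by
    ext i j
    rw [frameGram_apply, PseudoRiemannianMetric.toBilinForm_apply, Matrix.one_apply]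
    split_ifs with hij
    · rw [hij]; exact hb.1 j
    · exact hb.2 i j hij
  have hW : frameCurv (g.toBilinForm x) (trilinOfCLM (g.riemann x)) b =
      fun a c k l ↦ g.curvatureForm g.leviCivita x (b k) (b l) (b c) (b a) := by
    funext a c k l
    rfl
  rw [hG, Matrix.det_one, mul_one, hW, pfaffPair_eq_pfaffianSumFour]
  ring

/-! ### The divergence of the Chern field is the Euler form -/

/-- **`div X = Pf(Ω)` off the zeros of `Y`** (Chern 1944, (23)–(24): `Ω = dΠ` on the unit sphere
bundle, pulled back by the unit field). For a Riemannian metric `g` on a `4`-manifold, a vector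
field `Y` smooth on the chart domain of `x` and `Y x ≠ 0`, the divergence of the Chern field at `x`
is the Euler form `eulerForm g x` (`= ½(¼|W|² + σ₂(A))`, `EulerFormFour.lean`). Proof: read the
divergence in the chart at `x` (`vectorDivergence_eq_divAt_metricRep`), pass to divergence form
`(√det g)⁻¹ ∑ᵢ ∂ᵢ(√det g Xⁱ)` (`sum_coordPartial_sqrt_det_mul`), identify `√det g Xⁱ = Πᵢ`
(`sqrt_det_mul_chernCoordField`), apply Chern's coordinate identity `∑ᵢ ∂ᵢΠᵢ = E`
(`div_chernTransgression_eq_eulerDensity_holds`) and read `E/√det g` back as the Euler form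
(`pfaffOfFrame_coordBasis`, `pfaffOfFrame_metricRep`, `eulerForm_eq_pfaffOfFrame`).
[cite: Chern1944, (23)–(24)] [cite: Chern1945, (11)] -/
theorem vectorDivergence_chernField (hg : g.IsRiemannian) {Y : Π x : M, TangentSpace (𝓡 4) x}
    {x : M} (hY : ContMDiffOn (𝓡 4) ((𝓡 4).prod 𝓘(ℝ, 𝔼⁴)) ∞ (secTM Y)
      (chartAt (EuclideanSpace ℝ (Fin 4)) x).source) (hx : Y x ≠ 0) :
    g.vectorDivergence (chernField g Y) x = g.eulerForm x := by
  -- the chart at `x`, `u₀ = φ x`, `Φ u₀ = x`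
  set φ := extChartAt (𝓡 4) x with hφ
  set u₀ : chartTarget (𝓡 4) x := ⟨φ x, (extChartAt (𝓡 4) x).map_source
    (mem_extChartAt_source x)⟩ with hu₀
  have hxs : x ∈ (chartAt (EuclideanSpace ℝ (Fin 4)) x).source := mem_chart_source _ x
  have hΦu₀ : chartInv (𝓡 4) x u₀ = x := chartInv_extChartAt x hxs
  set Ĝ := metricRep (𝓡 4) g x with hĜdef
  set Ŷ := vectorRep (𝓡 4) x Y with hŶdef
  have hĜ : IsMetricOn Ĝ φ.target := OpensChart.isMetricOn_repr (val_chartPullback_eq_metricRep g x)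
  have hpos : ∀ e ∈ φ.target, ∀ v : 𝔼⁴, v ≠ 0 → 0 < Ĝ e v v := fun e he v hv ↦ metricRep_pos g hg x he v hv
  have hŶs : ContDiffOn ℝ ∞ Ŷ φ.target := contDiffOn_vectorRep x hY
  have hu₀t : (u₀ : 𝔼⁴) ∈ φ.target := u₀.2
  -- the open set where `Ŷ ≠ 0`
  set W₀ : Set 𝔼⁴ := φ.target ∩ Ŷ ⁻¹' {0}ᶜ with hW₀
  have hW₀o : IsOpen W₀ := hŶs.continuousOn.isOpen_inter_preimage (isOpen_extChartAt_target x)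
    isOpen_compl_singleton
  have hW₀t : W₀ ⊆ φ.target := inter_subset_left
  have hŶ0 : ∀ e ∈ W₀, Ŷ e ≠ 0 := fun e he ↦ he.2
  have hu₀W : (u₀ : 𝔼⁴) ∈ W₀ := by
    refine ⟨hu₀t, ?_⟩
    show Ŷ (φ x) ≠ 0
    rw [hŶdef, vectorRep_apply, hφ, extChartAt_to_inv x]
    exact fun h0 ↦ hx ((isInvertible_mfderiv_extChartAt (mem_extChartAt_source x)).injective
      (h0.trans (map_zero _).symm))
  -- `Y ≠ 0` at the points of `Φ(W₀)`
  have hYW : ∀ u : chartTarget (𝓡 4) x, (u : 𝔼⁴) ∈ W₀ → Y (chartInv (𝓡 4) x u) ≠ 0 := by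
    intro u hu h0
    apply hŶ0 u hu
    rw [hŶdef, vectorRep_apply, ← chartInv_apply, h0]
    exact map_zero _
  -- the representative of the Chern field near `u₀`
  set Xf := chernCoordField Ĝ Ŷ with hXf
  have heq : vectorRep (𝓡 4) x (chernField g Y) =ᶠ[𝓝 (u₀ : 𝔼⁴)] Xf := by
    filter_upwards [hW₀o.mem_nhds hu₀W] with e he
    exact vectorRep_chernField g hg x hY ⟨e, hW₀t he⟩ (hYW ⟨e, hW₀t he⟩ he)
  have hXfd : ContDiffAt ℝ ∞ Xf u₀ :=
    contDiffAt_chernCoordField hĜ hu₀t (hpos _ hu₀t) hŶs (hŶ0 _ hu₀W)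
  have hXrepd : DifferentiableAt ℝ (vectorRep (𝓡 4) x (chernField g Y)) u₀ :=
    (hXfd.differentiableAt (by simp)).congr_of_eventuallyEq heq
  have hXd : MDifferentiableAt (𝓡 4) ((𝓡 4).prod 𝓘(ℝ, 𝔼⁴)) (secTM (chernField g Y))
      (chartInv (𝓡 4) x u₀) := by
    rw [hΦu₀]
    exact (contMDiffAt_chernField g hg hY hx).mdifferentiableAt (by simp)
  -- (1) read the divergence in the chart
  have hdiv : g.vectorDivergence (chernField g Y) x = divAt Ĝ Xf u₀ := by
    have h1 := vectorDivergence_eq_divAt_metricRep g x u₀ hXd hXrepd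
    rw [hΦu₀] at h1
    rw [h1, divAt_congr_of_eventuallyEq heq]
  -- (2) divergence form and Chern's coordinate identity
  set S := chernSettingOf (Z := Ŷ) hĜ hpos hW₀o hW₀t ((hŶs.mono hW₀t).of_le (by norm_cast)) hŶ0
    with hS
  have hmem : ofLp (u₀ : 𝔼⁴) ∈ S.W := show toLp 2 (ofLp (u₀ : 𝔼⁴)) ∈ W₀ by
    rw [WithLp.toLp_ofLp]; exact hu₀W
  have hChern : ∑ i, coordPartial i (chernTransgression (metricMatrix Ĝ) (coordField Ŷ) i)
      (ofLp (u₀ : 𝔼⁴)) = eulerDensity (metricMatrix Ĝ) (ofLp (u₀ : 𝔼⁴)) :=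
    div_chernTransgression_eq_eulerDensity_holds 4 ⟨2, rfl⟩ S.U S.W S.g S.V S.hU S.hW
      S.hWU S.hg S.hgs S.hV S.hV0 (ofLp (u₀ : 𝔼⁴)) hmem
  -- the functions `√det g · Xⁱ` and `Πᵢ` agree near `u₀`
  have hfun : ∀ i : Fin 4, (fun y ↦ Real.sqrt (metricMatrix Ĝ y).det * coordField Xf y i) =ᶠ[𝓝 (ofLp (u₀ : 𝔼⁴))]
      chernTransgression (metricMatrix Ĝ) (coordField Ŷ) i := by
    intro i
    have hopen : IsOpen ((fun y : Fin 4 → ℝ ↦ (toLp 2 y : 𝔼⁴)) ⁻¹' W₀) :=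
      hW₀o.preimage (EuclideanSpace.equiv (Fin 4) ℝ).symm.continuous
    filter_upwards [hopen.mem_nhds (show toLp 2 (ofLp (u₀ : 𝔼⁴)) ∈ W₀ by
      rw [WithLp.toLp_ofLp]; exact hu₀W)] with y hy
    have hyt : (toLp 2 y : 𝔼⁴) ∈ φ.target := hW₀t hy
    have hq : 0 < Ĝ (toLp 2 y) (Ŷ (toLp 2 y)) (Ŷ (toLp 2 y)) := hpos _ hyt _ (hŶ0 _ hy)
    have hu : DifferentiableAt ℝ (metricUnitField Ĝ Ŷ) (toLp 2 y) :=
      (contDiffAt_metricUnitField hĜ hyt hŶs hq).differentiableAt (by simp)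
    have h := sqrt_det_mul_chernCoordField hĜ hyt (hpos _ hyt) hu i
    rw [WithLp.ofLp_toLp] at h
    rw [coordField_apply]
    exact h
  have hsum : ∑ i, coordPartial i (fun y ↦ Real.sqrt (metricMatrix Ĝ y).det * coordField Xf y i)
      (ofLp (u₀ : 𝔼⁴)) = eulerDensity (metricMatrix Ĝ) (ofLp (u₀ : 𝔼⁴)) := by
    rw [← hChern]
    exact Finset.sum_congr rfl fun i _ ↦ coordPartial_congr i (hfun i)
  have hdet : 0 < (metricMatrix Ĝ (ofLp (u₀ : 𝔼⁴))).det :=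
    (posDef_metricMatrix (hĜ.symm _ hu₀t) (hpos _ hu₀t)).det_pos
  have hdivform := sum_coordPartial_sqrt_det_mul hĜ hpos hu₀t (hXfd.differentiableAt (by simp))
  have hdivAt : divAt Ĝ Xf u₀ = (32 * (metricMatrix Ĝ (ofLp (u₀ : 𝔼⁴))).det)⁻¹ *
      pfaffPair (coordRiemann (metricMatrix Ĝ) (ofLp (u₀ : 𝔼⁴)))
        (coordRiemann (metricMatrix Ĝ) (ofLp (u₀ : 𝔼⁴))) := by
    have hs : Real.sqrt (metricMatrix Ĝ (ofLp (u₀ : 𝔼⁴))).det ≠ 0 := (Real.sqrt_pos.2 hdet).ne'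
    have hsq : Real.sqrt (metricMatrix Ĝ (ofLp (u₀ : 𝔼⁴))).det ^ 2 = (metricMatrix Ĝ (ofLp (u₀ : 𝔼⁴))).det :=
      Real.sq_sqrt hdet.le
    rw [hsum, eulerDensity_four] at hdivform
    rw [← hsq]
    field_simp
    field_simp at hdivform
    linarith [hdivform]
  -- (3) back to the manifold
  rw [hdiv, hdivAt, ← pfaffOfFrame_coordBasis hĜ hu₀t, pfaffOfFrame_metricRep g x u₀, hΦu₀,
    eulerForm_eq_pfaffOfFrame g hg x]

end Manifold

end Literature.Geometry.Riemannian

end
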